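import Mathlib
import Summits.Ventures.Crystal3D.Theorems.StickyWulffConstantStackingLiminfSliceExact
import Summits.Ventures.Crystal3D.Theorems.StickyWulffConstantStackingLiminfStackVolume
import HarnessLib

/-!
# The STACK VOLUME LAW `|W_f| = 4√2 (16 + f(1−f))` (banked companion of line `LayerChain`, crux
# `StackingLiminf`, stmt-Ventures-19145)

Route `StickyWulffConstant` of the venture `Summits/Ventures/Crystal3D` (cell `crystal3d-full`).
The planner's typed companion statement `StackVolumeLaw` of the line skeleton `LayerChain.lean` v3
(cf-p1 gen 10), PROVED over the landed vocabulary (`stackWulff`, `StickyWulffConstantLayerChainDefs`):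
for `0 ≤ f ≤ 1`, `volume (stackWulff f) = 4√2 (16 + f(1−f))` — `f = 0`: `64√2`, the truncated octahedron
of the fcc word at bond length `1`; `f = ½`: CKL's factor `65/64` for hcp; certified exactly beforehand by
cf-p2 R19 (kit j257743 / j257744).  Proof: Cavalieri over the height (`volume_stackWulff_eq_lintegral`
of `…StackSlicing.lean`, crystal3d-full eng, which also has the LOWER half and the value at `f = 0`),
the EXACT section areas of `…SliceExact.lean` on the three chambers `|Z| ≤ 1`, `1 ≤ ±Z ≤ 3`
(`y = √(2/3)·Z`; these use the general-`f` OUTER bounds of `…SliceMinkowski.lean`, the new input),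
emptiness beyond, and three quadratic integrals (`integral_quadratic`, `…StackVolume.lean`).
WHAT THIS IS NOT: not a registered stub; nothing about the chimera; rung F-C1 not moved.
-/

noncomputable section

namespace Summit.Ventures.Crystal3D.Theorems

open MeasureTheory Set
open Summit.Ventures.Crystal3D.LayerChain

/-- A set integral over a chamber as `h` times a `Z`-integral (`y = hZ`, `h = √(2/3)`), as an
`ENNReal.ofReal` of the lintegral of a nonnegative continuous density. -/
theorem setLIntegral_chamber (g : ℝ → ℝ) (hg : Continuous g) (a b : ℝ) (hab : a ≤ b)
    (hnn : ∀ Z, a ≤ Z → Z ≤ b → 0 ≤ g Z) (s : Set ℝ) (hs : MeasurableSet s)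
    (hs1 : s ⊆ Icc (Real.sqrt (2 / 3) * a) (Real.sqrt (2 / 3) * b))
    (hs2 : Ioo (Real.sqrt (2 / 3) * a) (Real.sqrt (2 / 3) * b) ⊆ s) :
    ∫⁻ y in s, ENNReal.ofReal (g (y / Real.sqrt (2 / 3))) =
      ENNReal.ofReal (Real.sqrt (2 / 3) * ∫ Z in a..b, g Z) := by
  set h := Real.sqrt (2 / 3) with hh
  have hpos : 0 < h := Real.sqrt_pos.2 (by norm_num)
  have hcont : Continuous fun y => g (y / h) := hg.comp (continuous_id.div_const h)
  -- the set integral equals the integral over `Ioo`, then the interval integral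
  have hIcc : IntegrableOn (fun y => g (y / h)) (Icc (h * a) (h * b)) volume := hcont.integrableOn_Icc
  have hnn' : ∀ y ∈ Icc (h * a) (h * b), 0 ≤ g (y / h) := by
    intro y hy
    apply hnn
    · rw [le_div_iff₀ hpos]; linarith [hy.1, mul_comm h a]
    · rw [div_le_iff₀ hpos]; linarith [hy.2, mul_comm h b]
  rw [← ofReal_integral_eq_lintegral_ofReal (hIcc.mono_set hs1)
    (ae_restrict_of_forall_mem hs fun y hy => hnn' y (hs1 hy))]
  congr 1
  -- `∫ over s` = `∫ over Ioc` (they differ from `Ioo ⊆ s ⊆ Icc` by null sets)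
  have e1 : ∫ y in s, g (y / h) = ∫ y in Icc (h * a) (h * b), g (y / h) := by
    apply setIntegral_congr_set
    refine ae_eq_of_subset_of_measure_ge hs1 ?_ hs.nullMeasurableSet measure_Icc_lt_top.ne
    calc volume (Icc (h * a) (h * b)) = volume (Ioo (h * a) (h * b)) := by
          rw [Real.volume_Icc, Real.volume_Ioo]
      _ ≤ volume s := measure_mono hs2
  rw [e1, integral_Icc_eq_integral_Ioc, ← intervalIntegral.integral_of_le (by nlinarith),
    show h * a = a * h from mul_comm _ _, show h * b = b * h from mul_comm _ _]
  have := intervalIntegral.integral_comp_div (f := g) (a := a * h) (b := b * h) hpos.ne'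
  rw [mul_div_cancel_right₀ a hpos.ne', mul_div_cancel_right₀ b hpos.ne', smul_eq_mul] at this
  rw [this]

/-- **The stack volume law** (`StackVolumeLaw` of the line skeleton, VERBATIM over the landed
vocabulary): `|W_f| = 4√2 (16 + f(1−f))` for `0 ≤ f ≤ 1`. -/
theorem stackVolumeLaw : ∀ f : ℝ, 0 ≤ f → f ≤ 1 →
    MeasureTheory.volume (stackWulff f) = ENNReal.ofReal (4 * Real.sqrt 2 * (16 + f * (1 - f))) := by
  intro f hf0 hf1
  have hpos : 0 < Real.sqrt (2 / 3) := Real.sqrt_pos.2 (by norm_num)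
  have hne : Real.sqrt (2 / 3) ≠ 0 := hpos.ne'
  have hs3 : 0 < Real.sqrt 3 := Real.sqrt_pos.2 (by norm_num)
  have hsq : Real.sqrt (2 / 3) * Real.sqrt 3 = Real.sqrt 2 := by
    rw [← Real.sqrt_mul (by norm_num)]; norm_num
  have hff : 0 ≤ f * (1 - f) := mul_nonneg hf0 (by linarith)
  -- the three chamber densities (functions of `Z = y/h`)
  set k := 1 + 2 * f * (1 - f) with hk
  have hk0 : 0 ≤ k := by rw [hk]; nlinarith
  set gM : ℝ → ℝ := fun Z => Real.sqrt 3 / 2 * (27 - ((1 - 2 * f) * Z) ^ 2) with hgM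
  set gT : ℝ → ℝ := fun Z => Real.sqrt 3 / 4 * (k * (3 - Z) ^ 2 + 12 * (3 - Z) + 24) with hgT
  set gB : ℝ → ℝ := fun Z => Real.sqrt 3 / 4 * (k * (3 + Z) ^ 2 + 12 * (3 + Z) + 24) with hgB
  have cM : Continuous gM := by rw [hgM]; fun_prop
  have cT : Continuous gT := by rw [hgT]; fun_prop
  have cB : Continuous gB := by rw [hgB]; fun_prop
  have nnM : ∀ Z, -1 ≤ Z → Z ≤ 1 → 0 ≤ gM Z := by
    intro Z h1 h2; rw [hgM]; simp only
    have : ((1 - 2 * f) * Z) ^ 2 ≤ 1 := by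
      rw [sq_le_one_iff_abs_le_one, abs_mul]
      calc |1 - 2 * f| * |Z| ≤ 1 * 1 :=
            mul_le_mul (abs_le.2 ⟨by linarith, by linarith⟩) (abs_le.2 ⟨h1, h2⟩)
              (abs_nonneg _) zero_le_one
        _ = 1 := by norm_num
    apply mul_nonneg (by positivity); linarith
  have nnT : ∀ Z, 1 ≤ Z → Z ≤ 3 → 0 ≤ gT Z := by
    intro Z h1 h2; rw [hgT]; simp only
    apply mul_nonneg (by positivity)
    nlinarith [mul_nonneg hk0 (sq_nonneg (3 - Z))]
  have nnB : ∀ Z, -3 ≤ Z → Z ≤ -1 → 0 ≤ gB Z := by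
    intro Z h1 h2; rw [hgB]; simp only
    apply mul_nonneg (by positivity)
    nlinarith [mul_nonneg hk0 (sq_nonneg (3 + Z))]
  -- pointwise: the section area at height `y`
  have hy : ∀ y : ℝ, y = Real.sqrt (2 / 3) * (y / Real.sqrt (2 / 3)) := fun y => by
    field_simp
  have eqM : EqOn (fun y => volume (stackSlice f y))
      (fun y => ENNReal.ofReal (gM (y / Real.sqrt (2 / 3))))
      (Icc (-Real.sqrt (2 / 3)) (Real.sqrt (2 / 3))) := by
    intro y hy'
    have h1 : -1 ≤ y / Real.sqrt (2 / 3) := by rw [le_div_iff₀ hpos]; linarith [hy'.1]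
    have h2 : y / Real.sqrt (2 / 3) ≤ 1 := by rw [div_le_iff₀ hpos]; linarith [hy'.2]
    show volume (stackSlice f y) = ENNReal.ofReal (gM (y / Real.sqrt (2 / 3)))
    rw [hy y, volume_stackSlice_mid f _ hf0 hf1 h1 h2, ← hy y]
  have eqT : EqOn (fun y => volume (stackSlice f y))
      (fun y => ENNReal.ofReal (gT (y / Real.sqrt (2 / 3))))
      (Ioc (Real.sqrt (2 / 3)) (3 * Real.sqrt (2 / 3))) := by
    intro y hy'
    have h1 : 1 ≤ y / Real.sqrt (2 / 3) := by rw [le_div_iff₀ hpos]; linarith [hy'.1]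
    have h2 : y / Real.sqrt (2 / 3) ≤ 3 := by rw [div_le_iff₀ hpos]; linarith [hy'.2]
    show volume (stackSlice f y) = ENNReal.ofReal (gT (y / Real.sqrt (2 / 3)))
    rw [hy y, volume_stackSlice_top f _ hf0 hf1 h1 h2, ← hy y]
  have eqB : EqOn (fun y => volume (stackSlice f y))
      (fun y => ENNReal.ofReal (gB (y / Real.sqrt (2 / 3))))
      (Ico (-(3 * Real.sqrt (2 / 3))) (-Real.sqrt (2 / 3))) := by
    intro y hy'
    have h1 : -3 ≤ y / Real.sqrt (2 / 3) := by rw [le_div_iff₀ hpos]; linarith [hy'.1]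
    have h2 : y / Real.sqrt (2 / 3) ≤ -1 := by rw [div_le_iff₀ hpos]; linarith [hy'.2]
    show volume (stackSlice f y) = ENNReal.ofReal (gB (y / Real.sqrt (2 / 3)))
    rw [hy y, volume_stackSlice_bot f _ hf0 hf1 h1 h2, ← hy y]
  have eq0 : EqOn (fun y => volume (stackSlice f y)) 0
      (Icc (-(3 * Real.sqrt (2 / 3))) (3 * Real.sqrt (2 / 3)))ᶜ := by
    intro y hy'
    simp only [mem_compl_iff, mem_Icc, not_and_or, not_le] at hy'
    have hZ : 3 < |y / Real.sqrt (2 / 3)| := by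
      rcases hy' with hlt | hlt
      · have : y / Real.sqrt (2 / 3) < -3 := by rw [div_lt_iff₀ hpos]; linarith
        have : |y / Real.sqrt (2 / 3)| = -(y / Real.sqrt (2 / 3)) := abs_of_neg (by linarith)
        linarith
      · have : 3 < y / Real.sqrt (2 / 3) := by rw [lt_div_iff₀ hpos]; linarith
        have : |y / Real.sqrt (2 / 3)| = y / Real.sqrt (2 / 3) := abs_of_pos (by linarith)
        linarith
    show volume (stackSlice f y) = 0
    rw [hy y]; exact volume_stackSlice_eq_zero f _ hf0 hf1 hZ
  -- Fubini and the partition of the height axis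
  rw [volume_stackWulff_eq_lintegral,
    ← lintegral_add_compl (fun y => volume (stackSlice f y)) (measurableSet_Icc : MeasurableSet
      (Icc (-(3 * Real.sqrt (2 / 3))) (3 * Real.sqrt (2 / 3)))),
    setLIntegral_eq_zero (measurableSet_Icc.compl) eq0, add_zero]
  have hunion : Icc (-(3 * Real.sqrt (2 / 3))) (3 * Real.sqrt (2 / 3)) =
      (Ico (-(3 * Real.sqrt (2 / 3))) (-Real.sqrt (2 / 3)) ∪
        Icc (-Real.sqrt (2 / 3)) (Real.sqrt (2 / 3))) ∪
        Ioc (Real.sqrt (2 / 3)) (3 * Real.sqrt (2 / 3)) := by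
    rw [Ico_union_Icc_eq_Icc (by linarith) (by linarith), Icc_union_Ioc_eq_Icc (by linarith)
      (by linarith)]
  have hd1 : Disjoint (Ico (-(3 * Real.sqrt (2 / 3))) (-Real.sqrt (2 / 3)) ∪
      Icc (-Real.sqrt (2 / 3)) (Real.sqrt (2 / 3))) (Ioc (Real.sqrt (2 / 3)) (3 * Real.sqrt (2 / 3))) := by
    refine disjoint_left.2 fun y hy1 hy2 => ?_
    simp only [mem_union, mem_Ico, mem_Icc, mem_Ioc] at hy1 hy2
    rcases hy1 with hy1 | hy1 <;> linarith [hy1.2, hy2.1]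
  have hd2 : Disjoint (Ico (-(3 * Real.sqrt (2 / 3))) (-Real.sqrt (2 / 3)))
      (Icc (-Real.sqrt (2 / 3)) (Real.sqrt (2 / 3))) := by
    refine disjoint_left.2 fun y hy1 hy2 => ?_
    simp only [mem_Ico, mem_Icc] at hy1 hy2
    linarith [hy1.2, hy2.1]
  rw [hunion, lintegral_union measurableSet_Ioc hd1, lintegral_union measurableSet_Icc hd2,
    setLIntegral_congr_fun measurableSet_Ico eqB, setLIntegral_congr_fun measurableSet_Icc eqM,
    setLIntegral_congr_fun measurableSet_Ioc eqT]
  -- the three chamber integrals as `h · ∫ dZ`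
  rw [setLIntegral_chamber gB cB (-3) (-1) (by norm_num) nnB _ measurableSet_Ico
      (fun y hy' => ⟨by linarith [hy'.1], by linarith [hy'.2]⟩)
      (fun y hy' => ⟨by linarith [hy'.1], by linarith [hy'.2]⟩),
    setLIntegral_chamber gM cM (-1) 1 (by norm_num) nnM _ measurableSet_Icc
      (fun y hy' => ⟨by linarith [hy'.1], by linarith [hy'.2]⟩)
      (fun y hy' => ⟨by linarith [hy'.1], by linarith [hy'.2]⟩),
    setLIntegral_chamber gT cT 1 3 (by norm_num) nnT _ measurableSet_Ioc
      (fun y hy' => ⟨by linarith [hy'.1], by linarith [hy'.2]⟩)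
      (fun y hy' => ⟨by linarith [hy'.1], by linarith [hy'.2]⟩)]
  -- evaluate the quadratic integrals
  have iB : ∫ Z in (-3 : ℝ)..(-1), gB Z = Real.sqrt 3 * (2 * k / 3 + 18) := by
    rw [intervalIntegral.integral_congr (g := fun Z => Real.sqrt 3 / 4 * (9 * k + 60) +
        Real.sqrt 3 / 4 * (6 * k + 12) * Z + Real.sqrt 3 / 4 * k * Z ^ 2)
        (fun Z _ => by simp only [hgB]; ring),
      integral_quadratic]
    ring
  have iM : ∫ Z in (-1 : ℝ)..1, gM Z = Real.sqrt 3 * (27 - (1 - 2 * f) ^ 2 / 3) := by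
    rw [intervalIntegral.integral_congr (g := fun Z => Real.sqrt 3 / 2 * 27 + 0 * Z +
        -(Real.sqrt 3 / 2 * (1 - 2 * f) ^ 2) * Z ^ 2) (fun Z _ => by simp only [hgM]; ring),
      integral_quadratic]
    ring
  have iT : ∫ Z in (1 : ℝ)..3, gT Z = Real.sqrt 3 * (2 * k / 3 + 18) := by
    rw [intervalIntegral.integral_congr (g := fun Z => Real.sqrt 3 / 4 * (9 * k + 60) +
        -(Real.sqrt 3 / 4 * (6 * k + 12)) * Z + Real.sqrt 3 / 4 * k * Z ^ 2)
        (fun Z _ => by simp only [hgT]; ring),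
      integral_quadratic]
    ring
  rw [iB, iM, iT]
  have p1 : 0 ≤ Real.sqrt (2 / 3) * (Real.sqrt 3 * (2 * k / 3 + 18)) := by positivity
  have p2 : 0 ≤ Real.sqrt (2 / 3) * (Real.sqrt 3 * (27 - (1 - 2 * f) ^ 2 / 3)) := by
    apply mul_nonneg hpos.le (mul_nonneg hs3.le ?_)
    nlinarith [sq_nonneg (1 - 2 * f)]
  rw [← ENNReal.ofReal_add p1 p2, ← ENNReal.ofReal_add (add_nonneg p1 p2) p1]
  congr 1
  rw [← hsq, hk]
  ring

end Summit.Ventures.Crystal3D.Theorems
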